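import Mathlib

/-!
# FM-door χ-budget law — kernel leg (hsemireg-alphabet-isogeny-1 g8)

EVIDENCE for the LINE `stmt-HodgeConjecture-18881 Cruxes/BlochSeedDiscOne/Lines/birth.lean 814a6a70c14e831a
stub_rung_pad4_seedAt`, not a rung.  Nothing here is proved toward HC ∕ HC_CM ∕ HC_AV ∕ №4 ∕ 26512 ∕ 18881 ∕ H2.
Mathlib-only; no `sorry`, no `instance`, no `notation`, no `allowUnsafeReducibility`.

Memo of record: `run/shared/lean/pub/pub-hsemireg/hsemireg-alphabet-isogeny-1/SPEC-ISOGENY-ALPHABET-isogeny1-g8.md`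
(«FM-DOOR χ-BUDGET LAW and the BLOCK-DIAGONAL NO-DOOR THEOREM»).  This file kernel-checks the arithmetic ∕ linear-algebra
steps; the sheaf-level matching lemma and the word dictionary (g0 §A.2) are pencil ∕ engine-tested in the memo.

* §1 `block_gap_formula`, `block_gap_ge_two`: for a box-symmetric block `[a; β]` (`β = x + iy`, positive definite:
  `x² + y² < a²`) and a nonzero psd one-block increment `[δ; ε]` (`ε = p + iq`, `p² + q² ≤ δ²`, `1 ≤ δ`) the block gap
  `χ(a+δ, β+ε) − χ(a, β) = 2(aδ − Re(β̄ε)) + (δ² − |ε|²)` is `≥ 2` (Cauchy–Schwarz in `ℤ²`).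
* §2 `budget_shapes`: unmatched letters cost `≥ 1` and pairs cost `≥ 2` in `χ` (alphabet F0); total `χ = 4` forces
  `r + 2p ≤ 4`, i.e. the shape list `p = 0` ∨ `p = 1 ∧ r ≤ 2` ∨ `p = 2 ∧ r = 0`.
* §3 the F0 kills: `kill_pairs_only` (a block untouched by every increment forces `τ₁ = 0`), `kill_3_1`, `kill_2_2`,
  `kill_2_11` (rows `p@g` and `(u@g,u@h)` force the common top `s = 1`, then `u@f₀` is infeasible), and the integer
  core of the general-alphabet `r = 1` kill (`kill_r1_core`, `kill_r1_diag`).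
* §4 `gram_kill`, `gram_mu_zero`: the GRAM LEMMA for positive shapes (four blocks, `r ≤ 4` letters).
* §5 the BLOCK-DIAGONAL theorem's steps: `gram_count` (untouched blocks `U` as an index type, `r ≤ |U|` ⇒ an uncharged
  untouched block), `caseA` (a block touched by one pair: `Gδ = Gδ′ = 0`, `δ + δ′ > 0 ⇒ G = 0`), `caseB` (a block touched
  by both pairs: the three rows force `ε₁G₁ + ε₂G₂ = 0`, the pair part of `μ`), `caseB'`, `untouched_budget`.

What is NOT here (pencil in the memo, standard facts cited there): the matching lemma (injective sheaf map ⇒ a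
matching along effective differences), `effective ⇒ nef ⇒ psd`, det-monotonicity under psd increments, cancellation of
isomorphic summands, Mukai's `IT₀ ⇒ Φ(G)` locally free of rank `χ(G)`, and the identification of the (H1) rows with
the per-block minors `(1, a, a′, β, β̄, aa′ − |β|²)` (g0 memo A.2, engine-tested).  Engine legs:
`code/fmdoor_blockdiag.py`, `code/fmdoor_box.py` → `data/g8/`.
-/

namespace HsemiregIsogeny1.FMDoorBudget

open Finset

/-! ## §1 Block gap of a box letter under a one-block psd increment -/

/-- `χ` of a box block `[a; β]`, `β = x + i y`: `a² − |β|²`. -/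
def chiBlock (a x y : ℤ) : ℤ := a ^ 2 - (x ^ 2 + y ^ 2)

theorem chiBlock_def (a x y : ℤ) : chiBlock a x y = a ^ 2 - (x ^ 2 + y ^ 2) := rfl

/-- The block-gap formula: `χ(a+δ, β+ε) − χ(a, β) = 2(aδ − Re(β̄ε)) + (δ² − |ε|²)` with `Re(β̄ε) = xp + yq`. -/
theorem block_gap_formula (a x y δ p q : ℤ) :
    chiBlock (a + δ) (x + p) (y + q) - chiBlock a x y
      = 2 * (a * δ - (x * p + y * q)) + (δ ^ 2 - (p ^ 2 + q ^ 2)) := by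
  simp only [chiBlock_def]; ring

/-- Cauchy–Schwarz in `ℤ²`. -/
theorem cauchy_schwarz_two (x y p q : ℤ) :
    (x * p + y * q) ^ 2 ≤ (x ^ 2 + y ^ 2) * (p ^ 2 + q ^ 2) := by
  nlinarith [sq_nonneg (x * q - y * p)]

/-- `Re(β̄ε) < aδ` for a positive definite block and a psd increment with `δ ≥ 1`. -/
theorem re_lt_of_pd_psd (a x y δ p q : ℤ) (ha : 0 < a) (hpd : x ^ 2 + y ^ 2 < a ^ 2) (hδ : 1 ≤ δ)
    (hpsd : p ^ 2 + q ^ 2 ≤ δ ^ 2) : x * p + y * q < a * δ := by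
  have hcs := cauchy_schwarz_two x y p q
  have h2 : (x ^ 2 + y ^ 2) * (p ^ 2 + q ^ 2) ≤ (x ^ 2 + y ^ 2) * δ ^ 2 :=
    mul_le_mul_of_nonneg_left hpsd (by positivity)
  have h3 : (x ^ 2 + y ^ 2) * δ ^ 2 < a ^ 2 * δ ^ 2 :=
    mul_lt_mul_of_pos_right hpd (by positivity)
  have hR : (x * p + y * q) ^ 2 < (a * δ) ^ 2 := by nlinarith
  have habs := abs_lt_of_sq_lt_sq hR (by positivity)
  exact (abs_lt.mp habs).2

/-- BLOCK GAP ≥ 2: a touched block (`δ ≥ 1`) of a positive definite box letter raises `χ` of that block by at least `2`. -/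
theorem block_gap_ge_two (a x y δ p q : ℤ) (ha : 0 < a) (hpd : x ^ 2 + y ^ 2 < a ^ 2) (hδ : 1 ≤ δ)
    (hpsd : p ^ 2 + q ^ 2 ≤ δ ^ 2) :
    2 ≤ chiBlock (a + δ) (x + p) (y + q) - chiBlock a x y := by
  rw [block_gap_formula]
  have := re_lt_of_pd_psd a x y δ p q ha hpd hδ hpsd
  nlinarith

/-- Block gap `= 2` forces `aδ − Re(β̄ε) = 1` and `|ε| = δ` (used in the shapes `[2]+[2]`, `[2]+[1,1]`). -/
theorem block_gap_eq_two (a x y δ p q : ℤ) (ha : 0 < a) (hpd : x ^ 2 + y ^ 2 < a ^ 2) (hδ : 1 ≤ δ)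
    (hpsd : p ^ 2 + q ^ 2 ≤ δ ^ 2) (h2 : chiBlock (a + δ) (x + p) (y + q) - chiBlock a x y = 2) :
    a * δ - (x * p + y * q) = 1 ∧ p ^ 2 + q ^ 2 = δ ^ 2 := by
  rw [block_gap_formula] at h2
  have := re_lt_of_pd_psd a x y δ p q ha hpd hδ hpsd
  constructor <;> omega

/-- Block gap `= 3` forces `aδ − Re(β̄ε) = 1` and `δ² − |ε|² = 1` (shape `[3]+[1]`). -/
theorem block_gap_eq_three (a x y δ p q : ℤ) (ha : 0 < a) (hpd : x ^ 2 + y ^ 2 < a ^ 2) (hδ : 1 ≤ δ)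
    (hpsd : p ^ 2 + q ^ 2 ≤ δ ^ 2) (h3 : chiBlock (a + δ) (x + p) (y + q) - chiBlock a x y = 3) :
    a * δ - (x * p + y * q) = 1 ∧ δ ^ 2 - (p ^ 2 + q ^ 2) = 1 := by
  rw [block_gap_formula] at h3
  have := re_lt_of_pd_psd a x y δ p q ha hpd hδ hpsd
  constructor <;> omega

/-- The total gap of a pair dominates the block gap: if the untouched blocks have `χ`-product `m ≥ 1`
then `g·m ≥ g`, and `g·m = 2` with `g ≥ 2` forces `m = 1` (other blocks unimodular). -/
theorem total_gap_two (g m : ℤ) (hg : 2 ≤ g) (hm : 1 ≤ m) (h : g * m = 2) : g = 2 ∧ m = 1 := by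
  have : m ≤ 1 := by nlinarith
  have hm1 : m = 1 := le_antisymm this hm
  subst hm1; constructor <;> omega

theorem total_gap_three (g m : ℤ) (hg : 2 ≤ g) (hm : 1 ≤ m) (h : g * m = 3) : g = 3 ∧ m = 1 := by
  have : m ≤ 1 := by nlinarith
  have hm1 : m = 1 := le_antisymm this hm
  subst hm1; constructor <;> omega

/-- Two touched blocks cost at least `8 > 4`: `(χ₀+g₀)(χ₁+g₁) m − χ₀ χ₁ m ≥ 8`. -/
theorem two_blocks_cost (χ₀ χ₁ g₀ g₁ m : ℤ) (h0 : 1 ≤ χ₀) (h1 : 1 ≤ χ₁) (hg0 : 2 ≤ g₀) (hg1 : 2 ≤ g₁)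
    (hm : 1 ≤ m) : 8 ≤ (χ₀ + g₀) * (χ₁ + g₁) * m - χ₀ * χ₁ * m := by
  have e : (χ₀ + g₀) * (χ₁ + g₁) * m - χ₀ * χ₁ * m = (g₀ * χ₁ + χ₀ * g₁ + g₀ * g₁) * m := by ring
  rw [e]
  have : 8 ≤ g₀ * χ₁ + χ₀ * g₁ + g₀ * g₁ := by nlinarith
  nlinarith

/-! ## §2 The χ-budget -/

/-- BUDGET: `r` unmatched letters (each `det ≥ 1`) and `p` pairs (each gap `≥ 2`, box alphabet) with
`Σ det + Σ gap = 4` satisfy `r + 2p ≤ 4`. -/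
theorem budget_shapes (r p : ℕ) (det : Fin r → ℕ) (gap : Fin p → ℕ)
    (hdet : ∀ i, 1 ≤ det i) (hgap : ∀ j, 2 ≤ gap j)
    (hsum : ∑ i, det i + ∑ j, gap j = 4) : r + 2 * p ≤ 4 := by
  have h1 : (Finset.univ : Finset (Fin r)).card • 1 ≤ ∑ i, det i :=
    Finset.card_nsmul_le_sum _ _ _ (fun i _ => hdet i)
  have h2 : (Finset.univ : Finset (Fin p)).card • 2 ≤ ∑ j, gap j :=
    Finset.card_nsmul_le_sum _ _ _ (fun j _ => hgap j)
  simp only [Finset.card_univ, Fintype.card_fin, smul_eq_mul] at h1 h2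
  omega

/-- The shape list. -/
theorem shape_list (r p : ℕ) (h : r + 2 * p ≤ 4) :
    p = 0 ∨ (p = 1 ∧ r ≤ 2) ∨ (p = 2 ∧ r = 0) := by omega

/-! ## §3 Order-1 and order-2 kills -/

/-- PAIRS ONLY (`[4]`, `[2,2]`): every increment touches one block, at most two pairs, four blocks — so some block
`f` is untouched; its order-1 `u`-row reads `0 = τ₁`; then the touched block's row `δ = τ₁` contradicts `δ ≥ 1`. -/
theorem kill_pairs_only (τ δ : ℤ) (huntouched : (0 : ℤ) = τ) (htouched : δ = τ) (hδ : 1 ≤ δ) : False := by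
  omega

/-- `[3]+[1]`: blocks `g ≠ f₀` give `χ_g(z) = τ₁² = 1`, block `f₀` gives `a_{z,f₀} = τ₁ − δ ≥ 1` — impossible. -/
theorem kill_3_1 (τ δ a : ℤ) (hτ : τ ^ 2 = 1) (hδ : 1 ≤ δ) (h : a + δ = τ) (ha : 1 ≤ a) : False := by
  nlinarith

/-- `[2]+[2]`: `det z = τ₁⁷ (τ₁ − 2δ) = 2` with `τ₁, δ ≥ 1` is impossible. -/
theorem kill_2_2 (τ δ : ℤ) (hτ : 1 ≤ τ) (hδ : 1 ≤ δ) (h : τ ^ 7 * (τ - 2 * δ) = 2) : False := by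
  rcases eq_or_lt_of_le hτ with rfl | hlt
  · norm_num at h; omega
  · have hpos : 0 < τ - 2 * δ := by
      by_contra hneg
      push Not at hneg
      have : τ ^ 7 * (τ - 2 * δ) ≤ 0 := mul_nonpos_of_nonneg_of_nonpos (by positivity) hneg
      omega
    have h7 : (2 : ℤ) ^ 7 ≤ τ ^ 7 := by gcongr; omega
    nlinarith

/-- Unimodular letters have equal tops at an untouched block: `a² − B = 1 = a′² − B`, `a, a′ > 0 ⇒ a = a′`
(`B = |β|²` is common because the order-1 e-row gives `β′ = −β`). -/
theorem tops_equal (a a' B : ℤ) (ha : 0 < a) (ha' : 0 < a') (h1 : a ^ 2 - B = 1) (h2 : a' ^ 2 - B = 1) :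
    a = a' := by
  have hsq : a ^ 2 = a' ^ 2 := by omega
  nlinarith [sq_nonneg (a - a'), sq_nonneg (a + a')]

/-- `[2]+[1,1]`: with `s` the common top of `z, z′` at the blocks `g ≠ f₀` (by `tops_equal`), the row `p@g` reads
`1 + 1 = τ₂` (both letters unimodular, the pair does not touch `g`), the row `(u@g, u@h)` (`g ≠ h`, both `≠ f₀`) reads
`s·s + s·s = τ₂`, hence `s = 1`; the order-1 row `u@f₀` reads `a + a′ + δ = τ₁ = 2s = 2` with `a, a′, δ ≥ 1`. -/
theorem kill_2_11 (s a a' δ τ₂ : ℤ) (hprow : (1 : ℤ) + 1 = τ₂) (huu : s * s + s * s = τ₂) (hs : 1 ≤ s)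
    (htop : a + a' + δ = 2 * s) (ha : 1 ≤ a) (ha' : 1 ≤ a') (hδ : 1 ≤ δ) : False := by
  nlinarith

/-- `r = 1` (one unmatched letter, general alphabet), integer core: `det x = τ₁^{8−m} q` with `m ≤ 3`, `q ≥ 1` and
`det x ≤ 3` force `τ₁ = 1` — for `τ₁ ≥ 2` the bound `τ₁^{8−m} q ≥ 2⁵ = 32` is violated. -/
theorem kill_r1_core (τ q : ℤ) (m : ℕ) (hm : m ≤ 3) (hτ : 2 ≤ τ) (hq : 1 ≤ q) (h : τ ^ (8 - m) * q ≤ 3) :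
    False := by
  have h5 : τ ^ 5 ≤ τ ^ (8 - m) := pow_le_pow_right₀ (by omega) (by omega)
  have h32 : (2 : ℤ) ^ 5 ≤ τ ^ 5 := by gcongr
  nlinarith

/-- `r = 1`, the case `τ₁ = 1`: `x = 1 − D` positive definite with `D` psd integral forces every diagonal entry of `D`
to vanish (`0 ≤ D_jj < 1`), hence `D = 0` — the diagonal step. -/
theorem kill_r1_diag (Djj : ℤ) (hpsd : 0 ≤ Djj) (hpd : 0 < 1 - Djj) : Djj = 0 := by omega

/-! ## §4 The GRAM LEMMA (positive shapes) -/

/-- GRAM LEMMA.  `r ≤ 4` letters with charges `β k f` (letter `k`, block `f`); the order-1 e-rows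
`Σ_k β k f = 0` and the order-2 `(e@f, ē@g)`-rows `Σ_k β k f · conj(β k g) = 0` (`f ≠ g`) force some block to be
uncharged in every letter.  Proof: `𝟙, v₀, …, v₃` (`v_f = (β k f)_k`) are five pairwise-orthogonal vectors of `ℂ^r`. -/
theorem gram_kill (r : ℕ) (hr : r ≤ 4) (β : Fin r → Fin 4 → ℂ)
    (h1 : ∀ f, ∑ k, β k f = 0)
    (h2 : ∀ f g, f ≠ g → ∑ k, β k f * starRingEnd ℂ (β k g) = 0) :
    ∃ f, ∀ k, β k f = 0 := by
  classical
  by_contra hne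
  push Not at hne
  have hr0 : 0 < r := by
    obtain ⟨k, _⟩ := hne 0
    exact Fin.pos k
  let v : Fin 4 → EuclideanSpace ℂ (Fin r) := fun f => WithLp.toLp 2 (fun k => β k f)
  let one : EuclideanSpace ℂ (Fin r) := WithLp.toLp 2 (fun _ => (1 : ℂ))
  let w : Fin 5 → EuclideanSpace ℂ (Fin r) := Fin.cons one v
  have hw0 : w 0 = one := rfl
  have hws : ∀ f : Fin 4, w f.succ = v f := fun f => by simp [w]
  have hw_ne : ∀ i, w i ≠ 0 := by
    intro i
    induction i using Fin.cases with
    | zero =>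
      intro h
      have := congrArg (fun x : EuclideanSpace ℂ (Fin r) => x ⟨0, hr0⟩) h
      simp [hw0, one] at this
    | succ f =>
      intro h
      obtain ⟨k, hk⟩ := hne f
      apply hk
      have := congrArg (fun x : EuclideanSpace ℂ (Fin r) => x k) h
      simpa [hws, v] using this
  have inner_vv : ∀ f g : Fin 4, @inner ℂ _ _ (v g) (v f) = ∑ k, β k f * starRingEnd ℂ (β k g) := by
    intro f g
    simp [v, EuclideanSpace.inner_toLp_toLp, dotProduct]
  have inner_1v : ∀ f : Fin 4, @inner ℂ _ _ one (v f) = ∑ k, β k f := by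
    intro f
    simp [v, one, EuclideanSpace.inner_toLp_toLp, dotProduct]
  have inner_v1 : ∀ f : Fin 4, @inner ℂ _ _ (v f) one = starRingEnd ℂ (∑ k, β k f) := by
    intro f
    rw [← inner_1v f, inner_conj_symm]
  have hw_orth : Pairwise fun i j => @inner ℂ _ _ (w i) (w j) = 0 := by
    intro i j hij
    induction i using Fin.cases with
    | zero =>
      induction j using Fin.cases with
      | zero => exact absurd rfl hij
      | succ g => rw [hw0, hws, inner_1v, h1]
    | succ f =>
      induction j using Fin.cases with
      | zero => rw [hw0, hws, inner_v1, h1, map_zero]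
      | succ g =>
        have hfg : g ≠ f := by
          intro h; apply hij; rw [h]
        rw [hws, hws, inner_vv, h2 g f hfg]
  have hli := linearIndependent_of_ne_zero_of_inner_eq_zero hw_ne hw_orth
  have hcard := hli.fintype_card_le_finrank
  rw [finrank_euclideanSpace_fin, Fintype.card_fin] at hcard
  omega

/-- Consequence: `μ = Σ_k Π_f β_{k,f} = 0` for every positive shape with at most four letters. -/
theorem gram_mu_zero (r : ℕ) (hr : r ≤ 4) (β : Fin r → Fin 4 → ℂ)
    (h1 : ∀ f, ∑ k, β k f = 0)
    (h2 : ∀ f g, f ≠ g → ∑ k, β k f * starRingEnd ℂ (β k g) = 0) :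
    ∑ k, ∏ f, β k f = 0 := by
  obtain ⟨f, hf⟩ := gram_kill r hr β h1 h2
  apply Finset.sum_eq_zero
  intro k _
  exact Finset.prod_eq_zero (Finset.mem_univ f) (hf k)

/-! ## §5 The BLOCK-DIAGONAL theorem: Gram count on the untouched blocks and the two pair cases -/

/-- GRAM COUNT (any shape, block-diagonal alphabet).  `ι` = the untouched blocks `U` (`r ≤ |U|`, `1 ≤ r` letters);
the e-rows and `(e, ē)`-rows supported on `U` see only the letters, so `𝟙` and the `v_f` (`f ∈ U`) are `|U| + 1 > r`
pairwise-orthogonal vectors of `ℂ^r`: some `v_f` vanishes, i.e. some untouched block is uncharged in every letter. -/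
theorem gram_count {ι : Type*} [Fintype ι] [DecidableEq ι] (r : ℕ) (hr : 1 ≤ r) (hU : r ≤ Fintype.card ι)
    (β : Fin r → ι → ℂ) (h1 : ∀ f, ∑ k, β k f = 0)
    (h2 : ∀ f g, f ≠ g → ∑ k, β k f * starRingEnd ℂ (β k g) = 0) :
    ∃ f, ∀ k, β k f = 0 := by
  classical
  by_contra hne
  push Not at hne
  let v : ι → EuclideanSpace ℂ (Fin r) := fun f => WithLp.toLp 2 (fun k => β k f)
  let one : EuclideanSpace ℂ (Fin r) := WithLp.toLp 2 (fun _ => (1 : ℂ))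
  let w : Option ι → EuclideanSpace ℂ (Fin r) := fun o => o.elim one v
  have hw0 : w none = one := rfl
  have hws : ∀ f, w (some f) = v f := fun f => rfl
  have hw_ne : ∀ i, w i ≠ 0 := by
    intro i
    cases i with
    | none =>
      intro h
      have := congrArg (fun x : EuclideanSpace ℂ (Fin r) => x ⟨0, hr⟩) h
      simp [hw0, one] at this
    | some f =>
      intro h
      obtain ⟨k, hk⟩ := hne f
      apply hk
      have := congrArg (fun x : EuclideanSpace ℂ (Fin r) => x k) h
      simpa [hws, v] using this
  have inner_vv : ∀ f g : ι, @inner ℂ _ _ (v g) (v f) = ∑ k, β k f * starRingEnd ℂ (β k g) := by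
    intro f g
    simp [v, EuclideanSpace.inner_toLp_toLp, dotProduct]
  have inner_1v : ∀ f : ι, @inner ℂ _ _ one (v f) = ∑ k, β k f := by
    intro f
    simp [v, one, EuclideanSpace.inner_toLp_toLp, dotProduct]
  have inner_v1 : ∀ f : ι, @inner ℂ _ _ (v f) one = starRingEnd ℂ (∑ k, β k f) := by
    intro f
    rw [← inner_1v f, inner_conj_symm]
  have hw_orth : Pairwise fun i j => @inner ℂ _ _ (w i) (w j) = 0 := by
    intro i j hij
    cases i with
    | none =>
      cases j with
      | none => exact absurd rfl hij
      | some g => rw [hw0, hws, inner_1v, h1]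
    | some f =>
      cases j with
      | none => rw [hw0, hws, inner_v1, h1, map_zero]
      | some g =>
        have hfg : g ≠ f := by
          intro h; apply hij; rw [h]
        rw [hws, hws, inner_vv, h2 g f hfg]
  have hli := linearIndependent_of_ne_zero_of_inner_eq_zero hw_ne hw_orth
  have hcard := hli.fintype_card_le_finrank
  rw [finrank_euclideanSpace_fin, Fintype.card_option] at hcard
  omega

/-- CASE A (a touched block `g` met by ONE pair): the words `(e@U, u@g)`, `(e@U, v@g)` read `G·δ = 0`, `G·δ′ = 0`
with `G = Π_{f∈U} γ_f` and `(δ, δ′)` the diagonal of the increment, `δ + δ′ = tr d > 0`; hence `G = 0` and the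
pair's term `ε·Γ` of `μ` vanishes (`Γ` is a multiple of `G`). -/
theorem caseA (G : ℂ) (δ δ' : ℝ) (h1 : G * δ = 0) (h2 : G * δ' = 0) (hpos : 0 < δ + δ') : G = 0 := by
  by_contra hG
  have e1 : (δ : ℂ) = 0 := (mul_eq_zero.mp h1).resolve_left hG
  have e2 : (δ' : ℂ) = 0 := (mul_eq_zero.mp h2).resolve_left hG
  have r1 : δ = 0 := by exact_mod_cast e1
  have r2 : δ' = 0 := by exact_mod_cast e2
  linarith

/-- CASE B (two pairs on the SAME block `g`; `U` = the other three blocks): the words `(e@U, u@g)`, `(e@U, v@g)`,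
`(e@U, ē@g)` read `G₁δ₁ + G₂δ₂ = 0`, `G₁δ₁′ + G₂δ₂′ = 0`, `G₁ε̄₁ + G₂ε̄₂ = 0` (`Gᵢ = Π_{f∈U} γ_{i,f}`); with both
first increment non-zero psd (`δ₁ + δ₁′ > 0`; the second is not even needed) the pair part `ε₁G₁ + ε₂G₂` of `μ = [eeee]` vanishes.  (Mechanism: `G₁ Ḡ₂` is
real, so `Ḡ₁G₂ = G₁Ḡ₂`, and `Ḡ₂·(ε₁G₁ + ε₂G₂) = G₂·(Ḡ₁ε₁ + Ḡ₂ε₂) = 0`.) -/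
theorem caseB (G₁ G₂ ε₁ ε₂ : ℂ) (δ₁ δ₁' δ₂ δ₂' : ℝ) (hd1 : 0 < δ₁ + δ₁')
    (hu : G₁ * δ₁ + G₂ * δ₂ = 0) (hv : G₁ * δ₁' + G₂ * δ₂' = 0)
    (he : G₁ * starRingEnd ℂ ε₁ + G₂ * starRingEnd ℂ ε₂ = 0) :
    ε₁ * G₁ + ε₂ * G₂ = 0 := by
  have hec : starRingEnd ℂ G₁ * ε₁ + starRingEnd ℂ G₂ * ε₂ = 0 := by
    have := congrArg (starRingEnd ℂ) he
    simpa [map_add, map_mul] using this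
  by_cases hG2 : G₂ = 0
  · subst hG2
    have hG1 : G₁ = 0 := caseA G₁ δ₁ δ₁' (by simpa using hu) (by simpa using hv) hd1
    simp [hG1]
  · -- G₁ conj G₂ is real
    have hA : ((δ₁ + δ₁' : ℝ) : ℂ) ≠ 0 := by exact_mod_cast hd1.ne'
    have heq : G₁ * starRingEnd ℂ G₂ * ((δ₁ + δ₁' : ℝ) : ℂ)
        = -(G₂ * starRingEnd ℂ G₂) * ((δ₂ + δ₂' : ℝ) : ℂ) := by
      push_cast
      linear_combination (starRingEnd ℂ G₂) * hu + (starRingEnd ℂ G₂) * hv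
    have hquot : G₁ * starRingEnd ℂ G₂
        = -(G₂ * starRingEnd ℂ G₂) * ((δ₂ + δ₂' : ℝ) : ℂ) / ((δ₁ + δ₁' : ℝ) : ℂ) := by
      rw [eq_div_iff hA]; exact heq
    have hnorm : G₂ * starRingEnd ℂ G₂ = ((Complex.normSq G₂ : ℝ) : ℂ) := Complex.mul_conj G₂
    have hconj : starRingEnd ℂ (G₁ * starRingEnd ℂ G₂) = G₁ * starRingEnd ℂ G₂ := by
      rw [hquot, hnorm]
      simp only [map_neg, map_mul, map_div₀, Complex.conj_ofReal]
    have comm : starRingEnd ℂ G₁ * G₂ = G₁ * starRingEnd ℂ G₂ := by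
      have h := hconj
      rw [map_mul, Complex.conj_conj] at h
      exact h
    have hc2 : starRingEnd ℂ G₂ ≠ 0 := by
      intro h; apply hG2; simpa using congrArg (starRingEnd ℂ) h
    apply mul_left_cancel₀ hc2
    rw [mul_zero]
    have key : starRingEnd ℂ G₂ * (ε₁ * G₁ + ε₂ * G₂)
        = G₂ * (starRingEnd ℂ G₁ * ε₁ + starRingEnd ℂ G₂ * ε₂)
          + ε₁ * (G₁ * starRingEnd ℂ G₂ - starRingEnd ℂ G₁ * G₂) := by ring
    rw [key, hec, mul_zero, zero_add, comm, sub_self, mul_zero]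

/-- CASE B with a charged untouched block `f₃` needs no new lemma: apply `caseB` to `Gᵢ·γ_{i,f₃}` (words with `e` at
ALL of `U`).  Recorded as the specialisation. -/
theorem caseB' (G₁ G₂ γ₁ γ₂ ε₁ ε₂ : ℂ) (δ₁ δ₁' δ₂ δ₂' : ℝ) (hd1 : 0 < δ₁ + δ₁')
    (hu : G₁ * γ₁ * δ₁ + G₂ * γ₂ * δ₂ = 0) (hv : G₁ * γ₁ * δ₁' + G₂ * γ₂ * δ₂' = 0)
    (he : G₁ * γ₁ * starRingEnd ℂ ε₁ + G₂ * γ₂ * starRingEnd ℂ ε₂ = 0) :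
    ε₁ * (G₁ * γ₁) + ε₂ * (G₂ * γ₂) = 0 :=
  caseB (G₁ * γ₁) (G₂ * γ₂) ε₁ ε₂ δ₁ δ₁' δ₂ δ₂' hd1 hu hv he

/-- BUDGET ⇒ enough untouched blocks: `r + p ≤ 4`, `|T| ≤ p` touched blocks, `|U| = 4 − |T|` ⇒ `r ≤ |U|`, and with
`1 ≤ r` the Gram count leaves `|U| + 1 − r ≥ 1` uncharged untouched blocks. -/
theorem untouched_budget (r p T U : ℕ) (hrp : r + p ≤ 4) (hT : T ≤ p) (hU : U = 4 - T) : r ≤ U := by omega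

end HsemiregIsogeny1.FMDoorBudget
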